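import Summits.QuantumFields.YangMills.Theorems.BalabanUVNodesN15UnitLayerBgDressing
import Literature.MathematicalPhysics.QuantumFieldTheory.Balaban1983to89.QGQInverse

/-!
# Route «BalabanUVNodes», cluster K4 «SpineRates» — node N15 = NE2, file V-B (dag-n15-a g17, programme V): THE EXACT (1.103) DRESSING
# `exDress b Δ Z := ((b·1 + Δ)⁻¹ + Sym Z)⁻¹ − (b·1 + Δ)` — symmetry, resolvent form, entry letters LINEAR in the middle factor, the η-difference letter (finite Combes–Thomas)

Cell `pub-ymgap`, seat `pub-ymgap-dag-n15-a` (-a KNIT-BY-NAME seat of node N15; HUMAN RULING D-0062; chair R424 venue), generation 17, file V-B of programme V (INBOX «DAGN15A-G17-INTENT-1»).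
`bears_on: R4∕N15 · K3⁷ SpineGivenEndpointR13SepCoPH (stmt-QuantumFields-20544)`.  Filed `--kind proof --supports stmt-QuantumFields-20544 --as helper` — COUNT-NEUTRAL.  One data `def`
(`exDress`), the rest theorems; 0 `sorry`.  Imports U-B (`symPart`, `abs_symPart_le`, `abs_smul_one_add_le`, King's `triple_decay_bound`) and pub-balaban's `QGQInverse` (`Coercive`, `inverse_decay`,
`coercive_of_form_perturbation`, `form_abs_le_of_schur`, `isUnit_of_coercive`); nothing in the tree is modified.
WHY.  By (1.103) (`(Q G Q*)⁻¹ = b + Δ_k`, V-A `inv_unitBondMat_sOp`) Bałaban's map `E ↦ (Q E Q*)⁻¹ − b` at a dressed propagator `E = G + W` reads, in the bond basis, `((b+Δ_k)⁻¹ + Z)⁻¹ − b`,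
`Z = Q W Q*`; U-B's `dressP b Δ_k Z = −Sym((b+Δ_k)Z(b+Δ_k))` is its first-order Taylor term.  This file treats the EXACT map (middle factor symmetrised, as the (2.156) engine wants symmetric
forms) on ANY finite index set with a pseudo-metric `ρ` and row-sum letters; the instance `Δ = deltaPol M n` is V-C.
WHAT.  §1 def `exDress`, `exDress_isSymm`, `exDress_zero`, `inv_inv_smul_one_add`, ★ `exDress_eq_neg_mul` (resolvent form `−(b+Δ)·Sym Z·((b+Δ)⁻¹ + Sym Z)⁻¹`), ★ `inv_sub_inv_eq`
(`T′A′ = 1`, `AT = 1` ⟹ `T′ − T = T′(A − A′)T`), `inv_smul_one_add_sub` (`S − S′ = S(Δ′ − Δ)S′`), ★ `exDress_sub_eq`.  §2 `exp_weight_le`, ★★ `abs_inv_le_of_coercive_decay` (FINITE COMBES–THOMAS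
in entry currency: `γ`-coercive + `|A| ≤ Ce^{−κρ}` + a row sum ⟹ `|A⁻¹| ≤ (γ − CVκ′∕τ)⁻¹e^{−κ′ρ}`), `coercive_smul_one_add`, `rowSum_abs_le`, `colSum_abs_le`, ★ `coercive_inv_of_coercive`
(`A⁻¹` is `γ∕R²`-coercive), `coercive_add_of_decay` (Schur), `rowSum_mono`, `entry_mono`, `one_le_of_rowSum`.  §3 `abs_smul_one_add_le'`, ★★ `abs_inv_smul_one_add_le` (`|(b+Δ)⁻¹| ≤ (2∕b)e^{−κ₁ρ}`),
★ `coercive_inv_smul_one_add` (`γ_S = b∕((b+c₀)V₁+1)²`), ★★ `abs_inv_add_symPart_le` (`|((b+Δ)⁻¹ + Sym Z)⁻¹| ≤ (4∕γ_S)e^{−κ₂ρ}`), ★★★ **`abs_exDress_le`** (`≤ (b+c₀)·ζ·(4∕γ_S)·V₃²·e^{−(κ₂∕2)ρ}` —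
LINEAR IN `ζ`), `abs_symPart_sub_le`, ★★★ **`abs_exDress_sub_le`** (`≤ ((4∕γ_S)²V₃²((2∕b)²V₂²θ + τ) + θ)e^{−(κ₂∕2)ρ}` from `|Δ′ − Δ| ≤ θe^{−κρ}`, `|Z′ − Z| ≤ τe^{−κρ}`).
HONEST FRAMING.  [folklore] finite linear algebra + the cell's kernel-checked Combes–Thomas lemma; NO estimate of [B5]∕[B6]∕[B9] is proved here; constants∕rates are this file's (halved rates,
explicit polynomials in `b, c₀, V`), absorbed in print's «O(1)», «δ».  N15 NOT discharged; nothing continuum ∕ ℝ⁴ ∕ OS ∕ mass-gap ∕ Clay.  Restate-immune (no Theses import).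
-/

set_option autoImplicit false

noncomputable section

open scoped BigOperators Matrix
open Finset Matrix

namespace Summit.QuantumFields.YangMills.BalabanUVNodes.N15.UnitLayerBg

open Literature.MathematicalPhysics.QuantumFieldTheory.Balaban1983to89
open Literature.MathematicalPhysics.QuantumFieldTheory.Balaban1983to89.QGQInverse (Coercive isUnit_of_coercive inverse_decay coercive_of_form_perturbation form_abs_le_of_schur)
open Literature.MathematicalPhysics.QuantumFieldTheory.King1986 (triple_decay_bound exp_decay_mono)

variable {ι : Type} [Fintype ι] [DecidableEq ι]

/-! ## §1 The exact dressing and its algebra -/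

section Algebra
/-- **THE EXACT (1.103) DRESSING** of a unit-lattice form `Δ` (averaging constant `b`) by a middle factor `Z`: `((b·1 + Δ)⁻¹ + Sym Z)⁻¹ − (b·1 + Δ)` — Bałaban's map
`E ↦ (Q E Q*)⁻¹ − b` at `Q E Q* = (b+Δ)⁻¹ + Z` (V-A: `(Q G Q*)⁻¹ = b + Δ_k`), minus `Δ`, with the middle factor symmetrised in the bond basis.
[cite: Balaban1984PropagatorsI, (1.102)–(1.103) p.34, (1.65)–(1.66) p.29; Balaban1985BackgroundPropagators, (3.185)–(3.187) p.432 (shape of `Δ_k(U)`)] -/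
def exDress (b : ℝ) (Δ Z : Matrix ι ι ℝ) : Matrix ι ι ℝ :=
  ((b • (1 : Matrix ι ι ℝ) + Δ)⁻¹ + symPart Z)⁻¹ - (b • (1 : Matrix ι ι ℝ) + Δ)
omit [Fintype ι] in
/-- `b·1 + Δ` is symmetric when `Δ` is. [folklore] -/
theorem isSymm_smul_one_add {Δ : Matrix ι ι ℝ} (hΔ : Δ.IsSymm) (b : ℝ) : (b • (1 : Matrix ι ι ℝ) + Δ).IsSymm :=
  (Matrix.isSymm_one.smul b).add hΔ
/-- The exact dressing of a symmetric form is symmetric. [folklore] -/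
theorem exDress_isSymm (b : ℝ) {Δ : Matrix ι ι ℝ} (hΔ : Δ.IsSymm) (Z : Matrix ι ι ℝ) : (exDress b Δ Z).IsSymm :=
  (((isSymm_smul_one_add hΔ b).inv).add (symPart_isSymm Z)).inv.sub (isSymm_smul_one_add hΔ b)
/-- `((b+Δ)⁻¹)⁻¹ = b+Δ` when `det (b+Δ)` is a unit. [folklore] -/
theorem inv_inv_smul_one_add {b : ℝ} {Δ : Matrix ι ι ℝ} (h : IsUnit (b • (1 : Matrix ι ι ℝ) + Δ).det) :
    ((b • (1 : Matrix ι ι ℝ) + Δ)⁻¹)⁻¹ = b • (1 : Matrix ι ι ℝ) + Δ :=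
  Matrix.nonsing_inv_nonsing_inv _ h
/-- No middle factor, no dressing: `exDress b Δ 0 = 0` (when `b+Δ` is invertible). [folklore] -/
theorem exDress_zero {b : ℝ} {Δ : Matrix ι ι ℝ} (h : IsUnit (b • (1 : Matrix ι ι ℝ) + Δ).det) : exDress b Δ 0 = 0 := by
  rw [exDress, symPart_zero, add_zero, inv_inv_smul_one_add h, sub_self]
/-- ★ **THE RESOLVENT FORM**: if `A := (b+Δ)⁻¹ + Sym Z` has a right inverse `T` (`A·T = 1`) and `b+Δ` is invertible, then `T − (b+Δ) = −(b+Δ)·Sym Z·T`.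
[cite: Balaban1985Variational, p.306 after (179) (second resolvent identity, shape)] [folklore] -/
theorem inv_sub_eq_neg_mul {b : ℝ} {Δ Z T : Matrix ι ι ℝ} (h : IsUnit (b • (1 : Matrix ι ι ℝ) + Δ).det)
    (hT : ((b • (1 : Matrix ι ι ℝ) + Δ)⁻¹ + symPart Z) * T = 1) :
    T - (b • (1 : Matrix ι ι ℝ) + Δ) = -((b • (1 : Matrix ι ι ℝ) + Δ) * symPart Z * T) := by
  have h1 : (b • (1 : Matrix ι ι ℝ) + Δ) * (((b • (1 : Matrix ι ι ℝ) + Δ)⁻¹ + symPart Z) * T) = b • (1 : Matrix ι ι ℝ) + Δ := by rw [hT, Matrix.mul_one]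
  rw [← Matrix.mul_assoc, Matrix.mul_add, Matrix.mul_nonsing_inv _ h, Matrix.add_mul, Matrix.one_mul] at h1
  rw [eq_neg_iff_add_eq_zero, sub_add_eq_add_sub, sub_eq_zero]
  exact h1
/-- ★ `exDress b Δ Z = −(b+Δ)·Sym Z·((b+Δ)⁻¹ + Sym Z)⁻¹` when both determinants are units. [folklore] -/
theorem exDress_eq_neg_mul {b : ℝ} {Δ Z : Matrix ι ι ℝ} (h : IsUnit (b • (1 : Matrix ι ι ℝ) + Δ).det)
    (hA : IsUnit (((b • (1 : Matrix ι ι ℝ) + Δ)⁻¹ + symPart Z)).det) :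
    exDress b Δ Z = -((b • (1 : Matrix ι ι ℝ) + Δ) * symPart Z * ((b • (1 : Matrix ι ι ℝ) + Δ)⁻¹ + symPart Z)⁻¹) :=
  inv_sub_eq_neg_mul h (Matrix.mul_nonsing_inv _ hA)
omit [DecidableEq ι] in
/-- ★ **THE SECOND RESOLVENT IDENTITY**: `T′A′ = 1`, `AT = 1` ⟹ `T′ − T = T′(A − A′)T`. [cite: Balaban1985Variational, p.306 after (179) (shape)] [folklore] -/
theorem inv_sub_inv_eq [DecidableEq ι] {A A' T T' : Matrix ι ι ℝ} (hT' : T' * A' = 1) (hT : A * T = 1) : T' - T = T' * (A - A') * T := by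
  rw [Matrix.mul_sub, Matrix.sub_mul, Matrix.mul_assoc, hT, Matrix.mul_one, hT', Matrix.one_mul]
/-- `S − S′ = S(Δ′ − Δ)S′` for `S = (b+Δ)⁻¹`, `S′ = (b+Δ′)⁻¹`. [folklore] -/
theorem inv_smul_one_add_sub {b : ℝ} {Δ Δ' : Matrix ι ι ℝ} (h : IsUnit (b • (1 : Matrix ι ι ℝ) + Δ).det) (h' : IsUnit (b • (1 : Matrix ι ι ℝ) + Δ').det) :
    (b • (1 : Matrix ι ι ℝ) + Δ)⁻¹ - (b • (1 : Matrix ι ι ℝ) + Δ')⁻¹ = (b • (1 : Matrix ι ι ℝ) + Δ)⁻¹ * (Δ' - Δ) * (b • (1 : Matrix ι ι ℝ) + Δ')⁻¹ := by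
  have e : Δ' - Δ = (b • (1 : Matrix ι ι ℝ) + Δ') - (b • (1 : Matrix ι ι ℝ) + Δ) := by abel
  rw [e, inv_sub_inv_eq (Matrix.nonsing_inv_mul _ h) (Matrix.mul_nonsing_inv _ h')]
/-- ★ **THE η-DIFFERENCE OF THE EXACT DRESSING, ALGEBRA**: with `S = (b+Δ)⁻¹`, `S′ = (b+Δ′)⁻¹`, `A = S + Sym Z`, `A′ = S′ + Sym Z′`, `T = A⁻¹`, `T′ = A′⁻¹` (all invertible):
`exDress b Δ′ Z′ − exDress b Δ Z = T′·S(Δ′ − Δ)S′·T + T′·(Sym Z − Sym Z′)·T − (Δ′ − Δ)`. [folklore] -/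
theorem exDress_sub_eq {b : ℝ} {Δ Δ' Z Z' : Matrix ι ι ℝ} (h : IsUnit (b • (1 : Matrix ι ι ℝ) + Δ).det) (h' : IsUnit (b • (1 : Matrix ι ι ℝ) + Δ').det)
    (hA : IsUnit ((b • (1 : Matrix ι ι ℝ) + Δ)⁻¹ + symPart Z).det) (hA' : IsUnit ((b • (1 : Matrix ι ι ℝ) + Δ')⁻¹ + symPart Z').det) :
    exDress b Δ' Z' - exDress b Δ Z =
      ((b • (1 : Matrix ι ι ℝ) + Δ')⁻¹ + symPart Z')⁻¹ * ((b • (1 : Matrix ι ι ℝ) + Δ)⁻¹ * (Δ' - Δ) * (b • (1 : Matrix ι ι ℝ) + Δ')⁻¹) * ((b • (1 : Matrix ι ι ℝ) + Δ)⁻¹ + symPart Z)⁻¹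
        + ((b • (1 : Matrix ι ι ℝ) + Δ')⁻¹ + symPart Z')⁻¹ * (symPart Z - symPart Z') * ((b • (1 : Matrix ι ι ℝ) + Δ)⁻¹ + symPart Z)⁻¹
        - (Δ' - Δ) := by
  have hTT := inv_sub_inv_eq (Matrix.nonsing_inv_mul _ hA') (Matrix.mul_nonsing_inv _ hA)
  have hAA : ((b • (1 : Matrix ι ι ℝ) + Δ)⁻¹ + symPart Z) - ((b • (1 : Matrix ι ι ℝ) + Δ')⁻¹ + symPart Z') =
      (b • (1 : Matrix ι ι ℝ) + Δ)⁻¹ * (Δ' - Δ) * (b • (1 : Matrix ι ι ℝ) + Δ')⁻¹ + (symPart Z - symPart Z') := by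
    rw [← inv_smul_one_add_sub h h']; abel
  have e : exDress b Δ' Z' - exDress b Δ Z =
      (((b • (1 : Matrix ι ι ℝ) + Δ')⁻¹ + symPart Z')⁻¹ - ((b • (1 : Matrix ι ι ℝ) + Δ)⁻¹ + symPart Z)⁻¹) - (Δ' - Δ) := by
    unfold exDress; abel
  rw [e, hTT, hAA, Matrix.mul_add, Matrix.add_mul]

end Algebra

/-! ## §2 The analysis: finite Combes–Thomas in entry currency, coercivity letters -/

section Analysis
omit [Fintype ι] [DecidableEq ι] in
/-- `e^{−δt}(e^{κ′t} − 1) ≤ (κ′∕τ)·e^{−(δ−κ′−τ)t}` for `κ′ ≥ 0`, `τ > 0` (every real `t`: `e^{κ′t} − 1 ≤ κ′te^{κ′t}`, `τt ≤ e^{τt}`). [folklore] -/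
theorem exp_weight_le {t κ' τ δ : ℝ} (hκ' : 0 ≤ κ') (hτ : 0 < τ) :
    Real.exp (-(δ * t)) * (Real.exp (κ' * t) - 1) ≤ κ' / τ * Real.exp (-((δ - κ' - τ) * t)) := by
  have h1 : Real.exp (κ' * t) - 1 ≤ κ' * t * Real.exp (κ' * t) := by
    have := Real.add_one_le_exp (-(κ' * t))
    have hpos := Real.exp_pos (κ' * t)
    have e : Real.exp (-(κ' * t)) * Real.exp (κ' * t) = 1 := by rw [← Real.exp_add, neg_add_cancel, Real.exp_zero]
    nlinarith [mul_le_mul_of_nonneg_right this hpos.le]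
  have h2 : κ' * t ≤ κ' / τ * Real.exp (τ * t) := by
    have := Real.add_one_le_exp (τ * t)
    rw [div_mul_eq_mul_div, le_div_iff₀ hτ]
    nlinarith
  have h3 : Real.exp (κ' * t) - 1 ≤ κ' / τ * Real.exp (τ * t) * Real.exp (κ' * t) :=
    h1.trans (mul_le_mul_of_nonneg_right h2 (Real.exp_pos _).le)
  calc Real.exp (-(δ * t)) * (Real.exp (κ' * t) - 1) ≤ Real.exp (-(δ * t)) * (κ' / τ * Real.exp (τ * t) * Real.exp (κ' * t)) :=
        mul_le_mul_of_nonneg_left h3 (Real.exp_pos _).le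
    _ = κ' / τ * Real.exp (-((δ - κ' - τ) * t)) := by
        rw [show -((δ - κ' - τ) * t) = -(δ * t) + τ * t + κ' * t by ring, Real.exp_add, Real.exp_add]; ring

variable (ρ : ι → ι → ℝ)
/-- ★★ **FINITE COMBES–THOMAS IN ENTRY CURRENCY.**  `A` `γ`-coercive with entries `|A(p,q)| ≤ Ce^{−κρ(p,q)}` over a pseudo-metric `ρ`; rates `κ′ ≥ 0`, `τ > 0` (useful when `κ′ + τ < κ`); a row
sum `Σ_q e^{−(κ−κ′−τ)ρ(p,q)} ≤ V`; and `CVκ′∕τ < γ`.  Then `|A⁻¹(p,q)| ≤ (γ − CVκ′∕τ)⁻¹e^{−κ′ρ(p,q)}` (`QGQInverse.inverse_decay` with the weighted sums bounded through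
`exp_weight_le`). [cite: CombesThomas1973, §II (mechanism); Balaban1985BackgroundPropagators, (3.132) p.422 (shape)] [folklore] -/
theorem abs_inv_le_of_coercive_decay (hρ : ∀ p q, 0 ≤ ρ p q) (hρs : ∀ p q, ρ p q = ρ q p) (hρ0 : ∀ p, ρ p p = 0) (hρt : ∀ p q r, ρ p r ≤ ρ p q + ρ q r)
    (A : Matrix ι ι ℝ) {γ C κ κ' τ V : ℝ} (hco : Coercive A γ) (hC : 0 ≤ C) (hκ' : 0 ≤ κ') (hτ : 0 < τ)
    (hA : ∀ p q, |A p q| ≤ C * Real.exp (-(κ * ρ p q))) (hV : ∀ p, ∑ q, Real.exp (-((κ - κ' - τ) * ρ p q)) ≤ V) (hsmall : C * V * κ' / τ < γ) (p q : ι) :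
    |A⁻¹ p q| ≤ (γ - C * V * κ' / τ)⁻¹ * Real.exp (-(κ' * ρ p q)) := by
  have hterm : ∀ p q, |A p q| * (Real.exp (κ' * ρ p q) - 1) ≤ C * (κ' / τ * Real.exp (-((κ - κ' - τ) * ρ p q))) := fun p q => by
    have hw : 0 ≤ Real.exp (κ' * ρ p q) - 1 := by
      rw [sub_nonneg]; exact Real.one_le_exp (mul_nonneg hκ' (hρ p q))
    calc |A p q| * (Real.exp (κ' * ρ p q) - 1) ≤ C * Real.exp (-(κ * ρ p q)) * (Real.exp (κ' * ρ p q) - 1) := mul_le_mul_of_nonneg_right (hA p q) hw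
      _ = C * (Real.exp (-(κ * ρ p q)) * (Real.exp (κ' * ρ p q) - 1)) := mul_assoc _ _ _
      _ ≤ C * (κ' / τ * Real.exp (-((κ - κ' - τ) * ρ p q))) := mul_le_mul_of_nonneg_left (exp_weight_le hκ' hτ) hC
  have hrow : ∀ p, ∑ q, |A p q| * (Real.exp (κ' * ρ p q) - 1) ≤ C * V * κ' / τ := fun p => by
    calc ∑ q, |A p q| * (Real.exp (κ' * ρ p q) - 1) ≤ ∑ q, C * (κ' / τ * Real.exp (-((κ - κ' - τ) * ρ p q))) := Finset.sum_le_sum fun q _ => hterm p q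
      _ = C * (κ' / τ) * ∑ q, Real.exp (-((κ - κ' - τ) * ρ p q)) := by rw [Finset.mul_sum]; exact Finset.sum_congr rfl fun q _ => by ring
      _ ≤ C * (κ' / τ) * V := mul_le_mul_of_nonneg_left (hV p) (mul_nonneg hC (div_nonneg hκ' hτ.le))
      _ = C * V * κ' / τ := by ring
  have hcol : ∀ q, ∑ p, |A p q| * (Real.exp (κ' * ρ p q) - 1) ≤ C * V * κ' / τ := fun q => by
    calc ∑ p, |A p q| * (Real.exp (κ' * ρ p q) - 1) ≤ ∑ p, C * (κ' / τ * Real.exp (-((κ - κ' - τ) * ρ p q))) := Finset.sum_le_sum fun p _ => hterm p q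
      _ = C * (κ' / τ) * ∑ p, Real.exp (-((κ - κ' - τ) * ρ q p)) := by
          rw [Finset.mul_sum]; exact Finset.sum_congr rfl fun p _ => by rw [hρs p q]; ring
      _ ≤ C * (κ' / τ) * V := mul_le_mul_of_nonneg_left (hV q) (mul_nonneg hC (div_nonneg hκ' hτ.le))
      _ = C * V * κ' / τ := by ring
  exact inverse_decay A ρ hsmall hκ' hco hρs hρ0 hρt hrow hcol p q
omit [DecidableEq ι] in
/-- `Δ ≥ 0` (as a real form) ⟹ `b·1 + Δ` is `b`-coercive. [folklore] -/
theorem coercive_smul_one_add [DecidableEq ι] {Δ : Matrix ι ι ℝ} (hΔp : ∀ x : ι → ℝ, 0 ≤ x ⬝ᵥ (Δ *ᵥ x)) (b : ℝ) : Coercive (b • (1 : Matrix ι ι ℝ) + Δ) b := by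
  intro x
  have h := hΔp x
  rw [Matrix.add_mulVec, dotProduct_add, Matrix.smul_mulVec, Matrix.one_mulVec, dotProduct_smul, smul_eq_mul]
  linarith
omit [DecidableEq ι] in
/-- absolute row sums from an entry letter and a row-sum letter: `|A| ≤ Ce^{−κρ}`, `Σ_q e^{−κρ} ≤ V` ⟹ `Σ_q |A(p,q)| ≤ CV`. [folklore] -/
theorem rowSum_abs_le {A : Matrix ι ι ℝ} {C κ V : ℝ} (hC : 0 ≤ C) (hA : ∀ p q, |A p q| ≤ C * Real.exp (-(κ * ρ p q)))
    (hV : ∀ p, ∑ q, Real.exp (-(κ * ρ p q)) ≤ V) (p : ι) : ∑ q, |A p q| ≤ C * V :=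
  calc ∑ q, |A p q| ≤ ∑ q, C * Real.exp (-(κ * ρ p q)) := Finset.sum_le_sum fun q _ => hA p q
    _ = C * ∑ q, Real.exp (-(κ * ρ p q)) := by rw [Finset.mul_sum]
    _ ≤ C * V := mul_le_mul_of_nonneg_left (hV p) hC
omit [DecidableEq ι] in
/-- the same for column sums (`ρ` symmetric). [folklore] -/
theorem colSum_abs_le (hρs : ∀ p q, ρ p q = ρ q p) {A : Matrix ι ι ℝ} {C κ V : ℝ} (hC : 0 ≤ C) (hA : ∀ p q, |A p q| ≤ C * Real.exp (-(κ * ρ p q)))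
    (hV : ∀ p, ∑ q, Real.exp (-(κ * ρ p q)) ≤ V) (q : ι) : ∑ p, |A p q| ≤ C * V :=
  calc ∑ p, |A p q| ≤ ∑ p, C * Real.exp (-(κ * ρ q p)) := Finset.sum_le_sum fun p _ => by rw [hρs q p]; exact hA p q
    _ = C * ∑ p, Real.exp (-(κ * ρ q p)) := by rw [Finset.mul_sum]
    _ ≤ C * V := mul_le_mul_of_nonneg_left (hV q) hC
/-- ★ **THE INVERSE OF A COERCIVE MATRIX IS COERCIVE**: `A` `γ`-coercive (`γ > 0`) with absolute row AND column sums `≤ R` (`R > 0`) ⟹ `A⁻¹` is `γ∕R²`-coercive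
(`⟨x, A⁻¹x⟩ = ⟨Ay, y⟩ ≥ γ‖y‖²` at `y = A⁻¹x`, and `‖x‖² = ‖Ay‖² ≤ R²‖y‖²` by the finite Schur test). [folklore] -/
theorem coercive_inv_of_coercive {A : Matrix ι ι ℝ} {γ R : ℝ} (hγ : 0 < γ) (hR : 0 < R) (hco : Coercive A γ)
    (hrow : ∀ p, ∑ q, |A p q| ≤ R) (hcol : ∀ q, ∑ p, |A p q| ≤ R) : Coercive A⁻¹ (γ / R ^ 2) := by
  intro x
  have hU : IsUnit A.det := (Matrix.isUnit_iff_isUnit_det A).mp (isUnit_of_coercive hγ hco)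
  set y := A⁻¹ *ᵥ x with hy
  have hAy : A *ᵥ y = x := by rw [hy, Matrix.mulVec_mulVec, Matrix.mul_nonsing_inv _ hU, Matrix.one_mulVec]
  -- ⟨x, A⁻¹x⟩ = ⟨Ay, y⟩ ≥ γ‖y‖²
  have h1 : γ * (y ⬝ᵥ y) ≤ x ⬝ᵥ y := by
    have := hco y
    rwa [hAy, dotProduct_comm y x] at this
  -- ‖x‖² ≤ R²‖y‖² (Schur)
  have h2 : x ⬝ᵥ x ≤ R ^ 2 * (y ⬝ᵥ y) := by
    have hS := SchurTest.sum_sq_le (fun p q => A p q) y hrow hcol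
    have e1 : x ⬝ᵥ x = ∑ p, (∑ q, A p q * y q) ^ 2 := by
      rw [← hAy]; simp only [dotProduct, Matrix.mulVec, pow_two]
    have e2 : y ⬝ᵥ y = ∑ q, y q ^ 2 := by simp only [dotProduct, pow_two]
    rw [e1, e2, pow_two]
    exact hS
  have hR2 : 0 < R ^ 2 := pow_pos hR 2
  rw [div_mul_eq_mul_div, div_le_iff₀ hR2]
  calc γ * (x ⬝ᵥ x) ≤ γ * (R ^ 2 * (y ⬝ᵥ y)) := mul_le_mul_of_nonneg_left h2 hγ.le
    _ = R ^ 2 * (γ * (y ⬝ᵥ y)) := by ring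
    _ ≤ R ^ 2 * (x ⬝ᵥ y) := mul_le_mul_of_nonneg_left h1 hR2.le
    _ = x ⬝ᵥ y * R ^ 2 := mul_comm _ _
omit [DecidableEq ι] in
/-- **A DECAYING PERTURBATION COSTS `ζV` OF COERCIVITY** (Schur): `S` `γ`-coercive, `|P| ≤ ζe^{−κρ}`, `Σ_q e^{−κρ} ≤ V` ⟹ `S + P` is `(γ − ζV)`-coercive. [folklore] -/
theorem coercive_add_of_decay (hρs : ∀ p q, ρ p q = ρ q p) {S P : Matrix ι ι ℝ} {γ ζ κ V : ℝ} (hco : Coercive S γ) (hζ : 0 ≤ ζ) (hV0 : 0 ≤ V)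
    (hP : ∀ p q, |P p q| ≤ ζ * Real.exp (-(κ * ρ p q))) (hV : ∀ p, ∑ q, Real.exp (-(κ * ρ p q)) ≤ V) : Coercive (S + P) (γ - ζ * V) := by
  refine coercive_of_form_perturbation hco fun x => ?_
  rw [add_sub_cancel_left]
  exact form_abs_le_of_schur P (ρ := ζ * V) (mul_nonneg hζ hV0) (le_of_eq (pow_two _).symm) (rowSum_abs_le ρ hζ hP hV) (colSum_abs_le ρ hρs hζ hP hV) x
omit [DecidableEq ι] in
/-- a row-sum letter at rate `a` serves every larger rate `a′ ≥ a` (`ρ ≥ 0`). [folklore] -/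
theorem rowSum_mono (hρ : ∀ p q, 0 ≤ ρ p q) {a a' V : ℝ} (haa : a ≤ a') (hV : ∀ p, ∑ q, Real.exp (-(a * ρ p q)) ≤ V) (p : ι) :
    ∑ q, Real.exp (-(a' * ρ p q)) ≤ V :=
  (Finset.sum_le_sum fun q _ => Real.exp_le_exp.mpr (by nlinarith [hρ p q, mul_le_mul_of_nonneg_right haa (hρ p q)])).trans (hV p)
omit [Fintype ι] [DecidableEq ι] in
/-- an entry letter at rate `κ` serves every smaller rate `κ′ ≤ κ` (`ρ ≥ 0`, constant `≥ 0`). [folklore] -/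
theorem entry_mono (hρ : ∀ p q, 0 ≤ ρ p q) {X : Matrix ι ι ℝ} {C κ κ' : ℝ} (hC : 0 ≤ C) (hκκ : κ' ≤ κ) (hX : ∀ p q, |X p q| ≤ C * Real.exp (-(κ * ρ p q))) (p q : ι) :
    |X p q| ≤ C * Real.exp (-(κ' * ρ p q)) :=
  (hX p q).trans (exp_decay_mono hC hκκ (hρ p q))
omit [DecidableEq ι] in
/-- a row-sum letter is at least `1` (the diagonal term) on a nonempty index set. [folklore] -/
theorem one_le_of_rowSum (hρ0 : ∀ p, ρ p p = 0) {a V : ℝ} (hV : ∀ p, ∑ q, Real.exp (-(a * ρ p q)) ≤ V) (p : ι) : 1 ≤ V := by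
  have h1 : Real.exp (-(a * ρ p p)) ≤ ∑ q, Real.exp (-(a * ρ p q)) :=
    Finset.single_le_sum (f := fun q => Real.exp (-(a * ρ p q))) (fun q _ => (Real.exp_pos _).le) (Finset.mem_univ p)
  rw [hρ0, mul_zero, neg_zero, Real.exp_zero] at h1
  exact h1.trans (hV p)

end Analysis

/-! ## §3 The letters of the exact dressing (rates `κ ≥ 4κ₁ ≥ 16κ₂`; row sums `V₁` at `κ∕4`, `V₂` at `κ₁∕4`, `V₃` at `κ₂∕2`) -/

section Letters

variable (ρ : ι → ι → ℝ)
omit [Fintype ι] in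
/-- entries of `b·1 + Δ` for `b > 0`: `≤ (b + c₀)e^{−κρ}` (U-B `abs_smul_one_add_le`). [folklore] -/
theorem abs_smul_one_add_le' (hρ0 : ∀ p, ρ p p = 0) {Δ : Matrix ι ι ℝ} {b c₀ κ : ℝ} (hb : 0 < b)
    (hΔ : ∀ p q, |Δ p q| ≤ c₀ * Real.exp (-(κ * ρ p q))) (p q : ι) :
    |(b • (1 : Matrix ι ι ℝ) + Δ) p q| ≤ (b + c₀) * Real.exp (-(κ * ρ p q)) := by
  have h := abs_smul_one_add_le ρ hρ0 (a := b) hΔ p q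
  rwa [abs_of_pos hb] at h
/-- ★★ **STAGE S — THE DECAY OF `(b·1 + Δ)⁻¹`**: `Δ ≥ 0` with `|Δ| ≤ c₀e^{−κρ}` (`b > 0`, `c₀ ≥ 0`, `κ > 0`), a rate `0 ≤ κ₁ ≤ κ∕4`, the row sum `Σ_q e^{−(κ∕4)ρ} ≤ V₁` and the
Combes–Thomas smallness `4(b + c₀)V₁κ₁ ≤ bκ` ⟹ `|(b·1 + Δ)⁻¹(p,q)| ≤ (2∕b)·e^{−κ₁ρ(p,q)}`. [cite: CombesThomas1973, §II (mechanism)] [folklore] -/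
theorem abs_inv_smul_one_add_le (hρ : ∀ p q, 0 ≤ ρ p q) (hρs : ∀ p q, ρ p q = ρ q p) (hρ0 : ∀ p, ρ p p = 0) (hρt : ∀ p q r, ρ p r ≤ ρ p q + ρ q r)
    {Δ : Matrix ι ι ℝ} {b c₀ κ κ₁ V₁ : ℝ} (hb : 0 < b) (hc₀ : 0 ≤ c₀) (hκ : 0 < κ) (hκ₁ : 0 ≤ κ₁) (hκ₁κ : κ₁ ≤ κ / 4)
    (hΔp : ∀ x : ι → ℝ, 0 ≤ x ⬝ᵥ (Δ *ᵥ x)) (hΔ : ∀ p q, |Δ p q| ≤ c₀ * Real.exp (-(κ * ρ p q)))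
    (hV₁ : ∀ p, ∑ q, Real.exp (-(κ / 4 * ρ p q)) ≤ V₁) (hs₁ : 4 * (b + c₀) * V₁ * κ₁ ≤ b * κ) (p q : ι) :
    |(b • (1 : Matrix ι ι ℝ) + Δ)⁻¹ p q| ≤ 2 / b * Real.exp (-(κ₁ * ρ p q)) := by
  have hV : ∀ p, ∑ q, Real.exp (-((κ - κ₁ - κ / 2) * ρ p q)) ≤ V₁ := rowSum_mono ρ hρ (by linarith) hV₁
  have hV₁1 : 1 ≤ V₁ := one_le_of_rowSum ρ hρ0 hV₁ p
  have hρw : (b + c₀) * V₁ * κ₁ / (κ / 2) ≤ b / 2 := by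
    rw [div_le_iff₀ (by positivity)]
    nlinarith
  have hsmall : (b + c₀) * V₁ * κ₁ / (κ / 2) < b := by linarith
  have h := abs_inv_le_of_coercive_decay ρ hρ hρs hρ0 hρt (b • (1 : Matrix ι ι ℝ) + Δ) (coercive_smul_one_add hΔp b) (by positivity) hκ₁ (half_pos hκ)
    (abs_smul_one_add_le' ρ hρ0 hb hΔ) hV hsmall p q
  refine h.trans (mul_le_mul_of_nonneg_right ?_ (Real.exp_pos _).le)
  rw [show (2 : ℝ) / b = (b / 2)⁻¹ by rw [inv_div]]
  exact inv_anti₀ (by positivity) (by linarith)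
/-- ★ `(b·1 + Δ)⁻¹` IS `γ_S`-COERCIVE, `γ_S = b∕((b + c₀)V₁ + 1)²` (`coercive_inv_of_coercive`: absolute row∕column sums of `b·1 + Δ` are `≤ (b + c₀)V₁`). [folklore] -/
theorem coercive_inv_smul_one_add (hρ : ∀ p q, 0 ≤ ρ p q) (hρs : ∀ p q, ρ p q = ρ q p) (hρ0 : ∀ p, ρ p p = 0)
    {Δ : Matrix ι ι ℝ} {b c₀ κ V₁ γS : ℝ} (hb : 0 < b) (hc₀ : 0 ≤ c₀) (hκ : 0 < κ) (hV₁0 : 0 ≤ V₁)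
    (hΔp : ∀ x : ι → ℝ, 0 ≤ x ⬝ᵥ (Δ *ᵥ x)) (hΔ : ∀ p q, |Δ p q| ≤ c₀ * Real.exp (-(κ * ρ p q)))
    (hV₁ : ∀ p, ∑ q, Real.exp (-(κ / 4 * ρ p q)) ≤ V₁) (hγS : γS = b / ((b + c₀) * V₁ + 1) ^ 2) :
    Coercive (b • (1 : Matrix ι ι ℝ) + Δ)⁻¹ γS := by
  have hVκ : ∀ p, ∑ q, Real.exp (-(κ * ρ p q)) ≤ V₁ := rowSum_mono ρ hρ (by linarith) hV₁
  have hA := abs_smul_one_add_le' ρ hρ0 hb hΔ (c₀ := c₀) (κ := κ)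
  rw [hγS]
  exact coercive_inv_of_coercive hb (by positivity) (coercive_smul_one_add hΔp b)
    (fun p => (rowSum_abs_le ρ (by positivity) hA hVκ p).trans (by linarith)) (fun q => (colSum_abs_le ρ hρs (by positivity) hA hVκ q).trans (by linarith))
/-- ★★ **STAGE T — THE DECAY OF `((b·1 + Δ)⁻¹ + Sym Z)⁻¹`**: with the data of Stage S, a middle factor `|Z| ≤ ζe^{−κρ}` (`ζ ≥ 0`), a rate `0 ≤ κ₂ ≤ κ₁∕4`, the row sum
`Σ_q e^{−(κ₁∕4)ρ} ≤ V₂`, the coercivity smallness `ζV₂ ≤ γ_S∕2` and the Combes–Thomas smallness `8(2∕b + ζ)V₂κ₂ ≤ γ_Sκ₁` ⟹ `|((b·1 + Δ)⁻¹ + Sym Z)⁻¹(p,q)| ≤ (4∕γ_S)e^{−κ₂ρ(p,q)}`,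
and this matrix is `(γ_S − ζV₂)`-coercive (`≥ γ_S∕2`). [cite: CombesThomas1973, §II (mechanism); Balaban1985Variational, p.306 («the new operator … has exactly the same properties»)] [folklore] -/
theorem abs_inv_add_symPart_le (hρ : ∀ p q, 0 ≤ ρ p q) (hρs : ∀ p q, ρ p q = ρ q p) (hρ0 : ∀ p, ρ p p = 0) (hρt : ∀ p q r, ρ p r ≤ ρ p q + ρ q r)
    {Δ Z : Matrix ι ι ℝ} {b c₀ κ κ₁ κ₂ V₁ V₂ ζ γS : ℝ} (hb : 0 < b) (hc₀ : 0 ≤ c₀) (hκ : 0 < κ) (hκ₁ : 0 < κ₁) (hκ₁κ : κ₁ ≤ κ / 4) (hκ₂ : 0 ≤ κ₂) (hκ₂κ : κ₂ ≤ κ₁ / 4)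
    (hζ : 0 ≤ ζ) (hΔp : ∀ x : ι → ℝ, 0 ≤ x ⬝ᵥ (Δ *ᵥ x)) (hΔ : ∀ p q, |Δ p q| ≤ c₀ * Real.exp (-(κ * ρ p q))) (hZ : ∀ p q, |Z p q| ≤ ζ * Real.exp (-(κ * ρ p q)))
    (hV₁ : ∀ p, ∑ q, Real.exp (-(κ / 4 * ρ p q)) ≤ V₁) (hV₂ : ∀ p, ∑ q, Real.exp (-(κ₁ / 4 * ρ p q)) ≤ V₂) (hγS : γS = b / ((b + c₀) * V₁ + 1) ^ 2)
    (hs₁ : 4 * (b + c₀) * V₁ * κ₁ ≤ b * κ) (hs₂ : ζ * V₂ ≤ γS / 2) (hs₃ : 8 * (2 / b + ζ) * V₂ * κ₂ ≤ γS * κ₁) :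
    Coercive ((b • (1 : Matrix ι ι ℝ) + Δ)⁻¹ + symPart Z) (γS - ζ * V₂) ∧
      ∀ p q : ι, |((b • (1 : Matrix ι ι ℝ) + Δ)⁻¹ + symPart Z)⁻¹ p q| ≤ 4 / γS * Real.exp (-(κ₂ * ρ p q)) := by
  rcases isEmpty_or_nonempty ι with hι | hι
  · exact ⟨fun x => by simp [dotProduct], fun p => isEmptyElim p⟩
  have hV₁1 : 1 ≤ V₁ := one_le_of_rowSum ρ hρ0 hV₁ (Classical.arbitrary ι)
  have hV₂1 : 1 ≤ V₂ := one_le_of_rowSum ρ hρ0 hV₂ (Classical.arbitrary ι)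
  have hV₂0 : 0 ≤ V₂ := by linarith
  have hγpos : 0 < γS := by rw [hγS]; positivity
  -- entries of S and of Sym Z at the rate κ₁
  have hS : ∀ p q, |(b • (1 : Matrix ι ι ℝ) + Δ)⁻¹ p q| ≤ 2 / b * Real.exp (-(κ₁ * ρ p q)) :=
    abs_inv_smul_one_add_le ρ hρ hρs hρ0 hρt hb hc₀ hκ hκ₁.le hκ₁κ hΔp hΔ hV₁ hs₁
  have hP : ∀ p q, |symPart Z p q| ≤ ζ * Real.exp (-(κ₁ * ρ p q)) := fun p q =>
    abs_symPart_le (entry_mono ρ hρ hζ (by linarith) hZ) (fun p q => by rw [hρs p q]) p q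
  have hA : ∀ p q, |((b • (1 : Matrix ι ι ℝ) + Δ)⁻¹ + symPart Z) p q| ≤ (2 / b + ζ) * Real.exp (-(κ₁ * ρ p q)) := fun p q => by
    rw [Matrix.add_apply, add_mul]
    exact (abs_add_le _ _).trans (add_le_add (hS p q) (hP p q))
  -- coercivity of A = S + Sym Z
  have hVκ₁ : ∀ p, ∑ q, Real.exp (-(κ₁ * ρ p q)) ≤ V₂ := rowSum_mono ρ hρ (by linarith) hV₂
  have hcoS := coercive_inv_smul_one_add ρ hρ hρs hρ0 hb hc₀ hκ (by linarith) hΔp hΔ hV₁ hγS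
  have hcoA : Coercive ((b • (1 : Matrix ι ι ℝ) + Δ)⁻¹ + symPart Z) (γS - ζ * V₂) := coercive_add_of_decay ρ hρs hcoS hζ hV₂0 hP hVκ₁
  refine ⟨hcoA, fun p q => ?_⟩
  -- Combes–Thomas for A at the rate κ₁, target rate κ₂, margin κ₁/2
  have hV : ∀ p, ∑ q, Real.exp (-((κ₁ - κ₂ - κ₁ / 2) * ρ p q)) ≤ V₂ := rowSum_mono ρ hρ (by linarith) hV₂
  have hC : 0 ≤ 2 / b + ζ := by positivity
  have hρw : (2 / b + ζ) * V₂ * κ₂ / (κ₁ / 2) ≤ γS / 4 := by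
    rw [div_le_iff₀ (by positivity)]
    nlinarith
  have hsmall : (2 / b + ζ) * V₂ * κ₂ / (κ₁ / 2) < γS - ζ * V₂ := by linarith
  have h := abs_inv_le_of_coercive_decay ρ hρ hρs hρ0 hρt _ hcoA hC hκ₂ (half_pos hκ₁) hA hV hsmall p q
  refine h.trans (mul_le_mul_of_nonneg_right ?_ (Real.exp_pos _).le)
  rw [show (4 : ℝ) / γS = (γS / 4)⁻¹ by rw [inv_div]]
  exact inv_anti₀ (by positivity) (by linarith)
/-- ★★★ **THE ENTRY LETTER OF THE EXACT DRESSING, LINEAR IN THE MIDDLE FACTOR**: with the data of Stages S and T and the row sum `Σ_q e^{−(κ₂∕2)ρ} ≤ V₃`,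
`|exDress b Δ Z (p,q)| ≤ (b + c₀)·ζ·(4∕γ_S)·V₃²·e^{−(κ₂∕2)ρ(p,q)}` (resolvent form + King's `triple_decay_bound`). [cite: King1986, (4.40)–(4.41) pp.674–675 (mechanism); Balaban1984PropagatorsI, (1.103) p.34 (object)] [folklore] -/
theorem abs_exDress_le (hρ : ∀ p q, 0 ≤ ρ p q) (hρs : ∀ p q, ρ p q = ρ q p) (hρ0 : ∀ p, ρ p p = 0) (hρt : ∀ p q r, ρ p r ≤ ρ p q + ρ q r)
    {Δ Z : Matrix ι ι ℝ} {b c₀ κ κ₁ κ₂ V₁ V₂ V₃ ζ γS : ℝ} (hb : 0 < b) (hc₀ : 0 ≤ c₀) (hκ : 0 < κ) (hκ₁ : 0 < κ₁) (hκ₁κ : κ₁ ≤ κ / 4) (hκ₂ : 0 ≤ κ₂) (hκ₂κ : κ₂ ≤ κ₁ / 4)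
    (hζ : 0 ≤ ζ) (hΔp : ∀ x : ι → ℝ, 0 ≤ x ⬝ᵥ (Δ *ᵥ x)) (hΔ : ∀ p q, |Δ p q| ≤ c₀ * Real.exp (-(κ * ρ p q))) (hZ : ∀ p q, |Z p q| ≤ ζ * Real.exp (-(κ * ρ p q)))
    (hV₁ : ∀ p, ∑ q, Real.exp (-(κ / 4 * ρ p q)) ≤ V₁) (hV₂ : ∀ p, ∑ q, Real.exp (-(κ₁ / 4 * ρ p q)) ≤ V₂) (hV₃ : ∀ p, ∑ q, Real.exp (-(κ₂ / 2 * ρ p q)) ≤ V₃)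
    (hγS : γS = b / ((b + c₀) * V₁ + 1) ^ 2) (hs₁ : 4 * (b + c₀) * V₁ * κ₁ ≤ b * κ) (hs₂ : ζ * V₂ ≤ γS / 2) (hs₃ : 8 * (2 / b + ζ) * V₂ * κ₂ ≤ γS * κ₁) (p q : ι) :
    |exDress b Δ Z p q| ≤ (b + c₀) * ζ * (4 / γS) * V₃ ^ 2 * Real.exp (-(κ₂ / 2 * ρ p q)) := by
  rcases isEmpty_or_nonempty ι with hι | hι
  · exact isEmptyElim p
  have hV₁1 : 1 ≤ V₁ := one_le_of_rowSum ρ hρ0 hV₁ p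
  have hγpos : 0 < γS := by rw [hγS]; positivity
  have hγA : 0 < γS - ζ * V₂ := by linarith
  obtain ⟨hcoA, hT⟩ := abs_inv_add_symPart_le ρ hρ hρs hρ0 hρt hb hc₀ hκ hκ₁ hκ₁κ hκ₂ hκ₂κ hζ hΔp hΔ hZ hV₁ hV₂ hγS hs₁ hs₂ hs₃
  have hU0 : IsUnit (b • (1 : Matrix ι ι ℝ) + Δ).det := (Matrix.isUnit_iff_isUnit_det _).mp (isUnit_of_coercive hb (coercive_smul_one_add hΔp b))
  have hUA : IsUnit ((b • (1 : Matrix ι ι ℝ) + Δ)⁻¹ + symPart Z).det := (Matrix.isUnit_iff_isUnit_det _).mp (isUnit_of_coercive hγA hcoA)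
  rw [exDress_eq_neg_mul hU0 hUA, Matrix.neg_apply, abs_neg]
  have h1 : ∀ p q, |(b • (1 : Matrix ι ι ℝ) + Δ) p q| ≤ (b + c₀) * Real.exp (-(κ₂ * ρ p q)) :=
    entry_mono ρ hρ (by positivity) (by linarith) (abs_smul_one_add_le' ρ hρ0 hb hΔ)
  have h2 : ∀ p q, |symPart Z p q| ≤ ζ * Real.exp (-(κ₂ * ρ p q)) := fun p q =>
    abs_symPart_le (entry_mono ρ hρ hζ (by linarith) hZ) (fun p q => by rw [hρs p q]) p q
  exact triple_decay_bound ρ hρ hρt _ _ _ hκ₂ (by positivity) hζ h1 h2 hT hV₃ p q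
omit [Fintype ι] [DecidableEq ι] in
/-- `|Sym Z − Sym Z′| ≤ τe^{−κρ}` from `|Z′ − Z| ≤ τe^{−κρ}` (`ρ` symmetric). [folklore] -/
theorem abs_symPart_sub_le (hρs : ∀ p q, ρ p q = ρ q p) {Z Z' : Matrix ι ι ℝ} {τ κ : ℝ} (hZZ : ∀ p q, |Z' p q - Z p q| ≤ τ * Real.exp (-(κ * ρ p q))) (p q : ι) :
    |(symPart Z - symPart Z') p q| ≤ τ * Real.exp (-(κ * ρ p q)) := by
  rw [symPart_sub]
  exact abs_symPart_le (X := Z - Z') (f := fun p q => τ * Real.exp (-(κ * ρ p q))) (fun p q => by rw [Matrix.sub_apply, abs_sub_comm]; exact hZZ p q)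
    (fun p q => by simp only [hρs p q]) p q
/-- ★★★ **THE η-DIFFERENCE LETTER OF THE EXACT DRESSING**: two forms `Δ, Δ′ ≥ 0` and two middle factors `Z, Z′` with the SAME letters as in `abs_exDress_le`, and the differences
`|Δ′ − Δ| ≤ θe^{−κρ}`, `|Z′ − Z| ≤ τe^{−κρ}` ⟹ `|exDress b Δ′ Z′ (p,q) − exDress b Δ Z (p,q)| ≤ ((4∕γ_S)²V₃²·((2∕b)²V₂²·θ + τ) + θ)·e^{−(κ₂∕2)ρ(p,q)}`
(`exDress_sub_eq` + `triple_decay_bound` ×3). [cite: King1986, (4.40)–(4.41) pp.674–675 (mechanism)] [folklore] -/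
theorem abs_exDress_sub_le (hρ : ∀ p q, 0 ≤ ρ p q) (hρs : ∀ p q, ρ p q = ρ q p) (hρ0 : ∀ p, ρ p p = 0) (hρt : ∀ p q r, ρ p r ≤ ρ p q + ρ q r)
    {Δ Δ' Z Z' : Matrix ι ι ℝ} {b c₀ κ κ₁ κ₂ V₁ V₂ V₃ ζ θ τ γS : ℝ} (hb : 0 < b) (hc₀ : 0 ≤ c₀) (hκ : 0 < κ) (hκ₁ : 0 < κ₁) (hκ₁κ : κ₁ ≤ κ / 4) (hκ₂ : 0 ≤ κ₂)
    (hκ₂κ : κ₂ ≤ κ₁ / 4) (hζ : 0 ≤ ζ) (hθ : 0 ≤ θ) (hτ : 0 ≤ τ)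
    (hΔp : ∀ x : ι → ℝ, 0 ≤ x ⬝ᵥ (Δ *ᵥ x)) (hΔ : ∀ p q, |Δ p q| ≤ c₀ * Real.exp (-(κ * ρ p q)))
    (hΔp' : ∀ x : ι → ℝ, 0 ≤ x ⬝ᵥ (Δ' *ᵥ x)) (hΔ' : ∀ p q, |Δ' p q| ≤ c₀ * Real.exp (-(κ * ρ p q)))
    (hZ : ∀ p q, |Z p q| ≤ ζ * Real.exp (-(κ * ρ p q))) (hZ' : ∀ p q, |Z' p q| ≤ ζ * Real.exp (-(κ * ρ p q)))
    (hΔΔ : ∀ p q, |Δ' p q - Δ p q| ≤ θ * Real.exp (-(κ * ρ p q))) (hZZ : ∀ p q, |Z' p q - Z p q| ≤ τ * Real.exp (-(κ * ρ p q)))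
    (hV₁ : ∀ p, ∑ q, Real.exp (-(κ / 4 * ρ p q)) ≤ V₁) (hV₂ : ∀ p, ∑ q, Real.exp (-(κ₁ / 4 * ρ p q)) ≤ V₂) (hV₃ : ∀ p, ∑ q, Real.exp (-(κ₂ / 2 * ρ p q)) ≤ V₃)
    (hγS : γS = b / ((b + c₀) * V₁ + 1) ^ 2) (hs₁ : 4 * (b + c₀) * V₁ * κ₁ ≤ b * κ) (hs₂ : ζ * V₂ ≤ γS / 2) (hs₃ : 8 * (2 / b + ζ) * V₂ * κ₂ ≤ γS * κ₁) (p q : ι) :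
    |exDress b Δ' Z' p q - exDress b Δ Z p q| ≤
      ((4 / γS) ^ 2 * V₃ ^ 2 * ((2 / b) ^ 2 * V₂ ^ 2 * θ + τ) + θ) * Real.exp (-(κ₂ / 2 * ρ p q)) := by
  rcases isEmpty_or_nonempty ι with hι | hι
  · exact isEmptyElim p
  have hV₁1 : 1 ≤ V₁ := one_le_of_rowSum ρ hρ0 hV₁ p
  have hV₂1 : 1 ≤ V₂ := one_le_of_rowSum ρ hρ0 hV₂ p
  have hV₃1 : 1 ≤ V₃ := one_le_of_rowSum ρ hρ0 hV₃ p
  have hγpos : 0 < γS := by rw [hγS]; positivity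
  have hγA : 0 < γS - ζ * V₂ := by linarith
  obtain ⟨hcoA, hT⟩ := abs_inv_add_symPart_le ρ hρ hρs hρ0 hρt hb hc₀ hκ hκ₁ hκ₁κ hκ₂ hκ₂κ hζ hΔp hΔ hZ hV₁ hV₂ hγS hs₁ hs₂ hs₃
  obtain ⟨hcoA', hT'⟩ := abs_inv_add_symPart_le ρ hρ hρs hρ0 hρt hb hc₀ hκ hκ₁ hκ₁κ hκ₂ hκ₂κ hζ hΔp' hΔ' hZ' hV₁ hV₂ hγS hs₁ hs₂ hs₃
  have hU0 : IsUnit (b • (1 : Matrix ι ι ℝ) + Δ).det := (Matrix.isUnit_iff_isUnit_det _).mp (isUnit_of_coercive hb (coercive_smul_one_add hΔp b))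
  have hU0' : IsUnit (b • (1 : Matrix ι ι ℝ) + Δ').det := (Matrix.isUnit_iff_isUnit_det _).mp (isUnit_of_coercive hb (coercive_smul_one_add hΔp' b))
  have hUA : IsUnit ((b • (1 : Matrix ι ι ℝ) + Δ)⁻¹ + symPart Z).det := (Matrix.isUnit_iff_isUnit_det _).mp (isUnit_of_coercive hγA hcoA)
  have hUA' : IsUnit ((b • (1 : Matrix ι ι ℝ) + Δ')⁻¹ + symPart Z').det := (Matrix.isUnit_iff_isUnit_det _).mp (isUnit_of_coercive hγA hcoA')
  have e := congrArg (fun N : Matrix ι ι ℝ => N p q) (exDress_sub_eq hU0 hU0' hUA hUA')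
  simp only [Matrix.sub_apply] at e
  rw [e, Matrix.add_apply]
  -- the inner factor X = S(Δ′−Δ)S′ at rate κ₁, then T′XT at rate κ₂
  have hS : ∀ p q, |(b • (1 : Matrix ι ι ℝ) + Δ)⁻¹ p q| ≤ 2 / b * Real.exp (-(κ₁ * ρ p q)) :=
    abs_inv_smul_one_add_le ρ hρ hρs hρ0 hρt hb hc₀ hκ hκ₁.le hκ₁κ hΔp hΔ hV₁ hs₁
  have hS' : ∀ p q, |(b • (1 : Matrix ι ι ℝ) + Δ')⁻¹ p q| ≤ 2 / b * Real.exp (-(κ₁ * ρ p q)) :=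
    abs_inv_smul_one_add_le ρ hρ hρs hρ0 hρt hb hc₀ hκ hκ₁.le hκ₁κ hΔp' hΔ' hV₁ hs₁
  have hΔΔ' : ∀ p q, |(Δ' - Δ) p q| ≤ θ * Real.exp (-(κ * ρ p q)) := fun p q => by rw [Matrix.sub_apply]; exact hΔΔ p q
  have hD : ∀ p q, |(Δ' - Δ) p q| ≤ θ * Real.exp (-(κ₁ * ρ p q)) := entry_mono ρ hρ hθ (by linarith) hΔΔ'
  have hVκ₁2 : ∀ p, ∑ q, Real.exp (-(κ₁ / 2 * ρ p q)) ≤ V₂ := rowSum_mono ρ hρ (by linarith) hV₂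
  have hX₁ := triple_decay_bound ρ hρ hρt _ _ _ hκ₁.le (by positivity : (0:ℝ) ≤ 2 / b) hθ hS hD hS' hVκ₁2
  have hX : ∀ p q, |((b • (1 : Matrix ι ι ℝ) + Δ)⁻¹ * (Δ' - Δ) * (b • (1 : Matrix ι ι ℝ) + Δ')⁻¹) p q| ≤ (2 / b) * θ * (2 / b) * V₂ ^ 2 * Real.exp (-(κ₂ * ρ p q)) :=
    entry_mono ρ hρ (by positivity) (by linarith) hX₁
  have t1 := triple_decay_bound ρ hρ hρt _ _ _ hκ₂ (by positivity : (0:ℝ) ≤ 4 / γS) (by positivity : (0:ℝ) ≤ (2 / b) * θ * (2 / b) * V₂ ^ 2) hT' hX hT hV₃ p q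
  have hPP : ∀ p q, |(symPart Z - symPart Z') p q| ≤ τ * Real.exp (-(κ₂ * ρ p q)) :=
    entry_mono ρ hρ hτ (by linarith) (abs_symPart_sub_le ρ hρs hZZ)
  have t2 := triple_decay_bound ρ hρ hρt _ _ _ hκ₂ (by positivity : (0:ℝ) ≤ 4 / γS) hτ hT' hPP hT hV₃ p q
  have t3 : |(Δ' - Δ) p q| ≤ θ * Real.exp (-(κ₂ / 2 * ρ p q)) := entry_mono ρ hρ hθ (by linarith) hΔΔ' p q
  rw [Matrix.mul_assoc] at t1
  have hassoc : ((b • (1 : Matrix ι ι ℝ) + Δ')⁻¹ + symPart Z')⁻¹ * ((b • (1 : Matrix ι ι ℝ) + Δ)⁻¹ * (Δ' - Δ) * (b • (1 : Matrix ι ι ℝ) + Δ')⁻¹) *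
      ((b • (1 : Matrix ι ι ℝ) + Δ)⁻¹ + symPart Z)⁻¹ =
      ((b • (1 : Matrix ι ι ℝ) + Δ')⁻¹ + symPart Z')⁻¹ * (((b • (1 : Matrix ι ι ℝ) + Δ)⁻¹ * (Δ' - Δ) * (b • (1 : Matrix ι ι ℝ) + Δ')⁻¹) *
      ((b • (1 : Matrix ι ι ℝ) + Δ)⁻¹ + symPart Z)⁻¹) := Matrix.mul_assoc _ _ _
  rw [hassoc]
  refine (abs_sub _ _).trans ((add_le_add ((abs_add_le _ _).trans (add_le_add t1 t2)) t3).trans (le_of_eq ?_))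
  ring

end Letters

end Summit.QuantumFields.YangMills.BalabanUVNodes.N15.UnitLayerBg

end
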